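import Literature.Computability.Complexity.GateEliminationTroubledPair


/-!
# Gate elimination: Case 7 of Li–Yang's proof of Theorem 4.1

"Assume that `I₁ = x` is a `2`-variable and `I₂ = Q` is a `1`-gate. Note that `x` is unprotected
and does not feed `Q` (otherwise `Q` is useless). We perform constant substitution to `x` to
trivialize `G` and eliminate four gates in total: `G`, `Q` and two descendants of `G` and `x`.
We now show that `ΔΦ ≤ 4`. 1. Since `Q` is eliminated by Rule 1, it has `ΔΦ ≤ 2`. 2. Since `G`
is trivialized and both of its inputs neither become nor feed troubled gates, it has `ΔΦ ≤ 0`.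
3. Since the other two gates are removed by Rule 3, each of them have `ΔΦ ≤ 1`. Hence
`Δμ ≥ 4 - 4α_φ + α_I ≥ δ` in total." (ECCC TR21-023, §4.1, Case 7; `G` is the topologically
minimal ∧-type gate, so `Q` is not ∧-type.)

## References

* J. Li, T. Yang, *3.1n − o(n) circuit lower bounds for explicit functions*, STOC 2022;
  ECCC TR21-023, §4.1 (Case 7), Lemma 3.11.
-/

namespace Literature.Computability.Complexity

open Finset

namespace Semicircuit

variable {n : ℕ} {C : Semicircuit n} {f : (Fin n → ZMod 2) → Bool} {R : RdqSource n} {d : ℕ}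
  {αφ αI αQ : ℝ} {P : Finset (Fin C.m × Fin C.m)}

/-- `CausedBy` a constant node is impossible. [folklore] -/
theorem not_causedBy_const {D : Semicircuit n} {ι : Fin D.m → Fin C.m} {b : Bool} {k : Fin D.m} :
    ¬ CausedBy C D ι (.const b) k := by
  rintro (h | ⟨z, h, -⟩) <;> cases h

/-- **Case 7 of Li–Yang's proof of Theorem 4.1**: an ∧-type gate `G` reads an unprotected
`2`-variable `x` and a `1`-gate `Q` that is not ∧-type (e.g. `G` topologically minimal), `G` is a
`1`-gate (Case 3), `x` does not feed `Q` and the reader of `G` does not read `x` (no useless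
gate), `Q` is not the output; then `x := c` trivializing `G` is followed by the eliminations of
`G` (`ΔΦ ≤ 0`), `Q` (Rule 1, `ΔΦ ≤ 2`) and two more gates fed by constants (`ΔΦ ≤ 1` each):
`Δμ ≥ 4 - 4α_φ + α_I ≥ δ`, `t = 1`. [cite: LiYang2022, §4.1 (Case 7)] -/
theorem case7 (hf : IsAffineDisperser f d) (hd : 2 * d + 2 < R.dim) (hF : C.Fair)
    (hC : C.ComputesRestr f R) (hP : C.IsPacking P) (hφ : 0 ≤ αφ) (hI : 0 ≤ αI) (αQ : ℝ)
    {G Q D H : Fin C.m} {x : Fin n} {aX aD aH : Fin 2}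
    (hand : IsAndOp (C.op G)) (hGx : C.arg G aX = .var x) (hGQ : C.arg G aX.rev = .gate Q)
    (hQand : ¬ IsAndOp (C.op Q)) (hxp : ¬ R.Protected x)
    (hQ1 : C.fanout (.gate Q) = 1) (hQx : ∀ a, C.arg Q a ≠ .var x) (hQout : C.out ≠ .gate Q)
    (hDx : C.arg D aD = .var x) (hDG : D ≠ G) (hHG : C.arg H aH = .gate G) (hHx : ∀ a, C.arg H a ≠ .var x) :
    C.StepBranch2 f R αφ αI αQ P := by
  classical
  have hx : R.Free x := free_of_reads hC hGx
  have hxinf : x ∈ C.influential R := C.mem_influential_of_reads R hGx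
  have hGK : G ∉ C.xorPart := C.not_mem_xorPart_of_isAndOp hand
  have hDH : D ≠ H := fun h => hHx aD (h ▸ hDx)
  have hHQ : H ≠ Q := by
    intro h; subst h
    -- `Q` reads `G` and `G` reads `Q`: impossible for the acyclic gate `G`
    by_cases hQK : H ∈ C.xorPart
    · exact hGK (C.mem_of_arg_eq H hQK aH G hHG)
    · obtain ⟨ρ, hρ⟩ := C.acyclic
      have h1 := hρ H hQK aH G hHG hGK
      have h2 := hρ G hGK _ H hGQ hQK
      omega
  have hDQ : D ≠ Q := fun h => hQx aD (h ▸ hDx)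
  have hHG' : H ≠ G := fun h => by rw [h] at hHG; exact C.arg_ne_self_of_not_mem hGK aH hHG
  -- the substitution `x := b` trivializing `G`
  obtain ⟨b, hb⟩ := exists_trivializing hand aX
  let c : ZMod 2 := finTwoEquiv.symm b
  have hbc : finTwoEquiv c = b := finTwoEquiv.apply_symm_apply b
  let C₁ := C.substConst x (finTwoEquiv c)
  let R₁ := R.assignFree x c hx hxp
  have hF₁ : C₁.Fair := hF.substConst x _
  have hC₁ : C₁.ComputesRestr f R₁ := hC.substConst_assignFree hx hxp c
  have hP₁ : C₁.IsPacking (C.substConstPacking x (finTwoEquiv c) P) := hP.substConst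
  have hd₁ : 2 * d + 2 ≤ R₁.dim := by
    have := RdqSource.dim_assignFree (b := c) hx hxp
    show 2 * d + 2 ≤ (R.assignFree x c hx hxp).dim; omega
  have h₀ : C₁.arg G aX = .const b := by
    show (C.arg G aX).substConst x (finTwoEquiv c) = _; rw [hGx, Node.substConst_var_self, hbc]
  have hG₁Q : C₁.arg G aX.rev = .gate Q := by
    show (C.arg G aX.rev).substConst x (finTwoEquiv c) = _; rw [hGQ]; rfl
  have htriv : C₁.liveFn G aX b false = C₁.liveFn G aX b true := hb
  have hout₁ : C₁.out ≠ .gate G := out_ne_of_trivialized hf (by omega) hF₁ hC₁ h₀ htriv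
  -- step 1: eliminate `G` (trivialized), introducing no troubled gate
  let E₁ := elimDataWTriv hF₁ hC₁ hP₁ h₀ htriv hout₁ hφ hI αQ
  have hnonew : ∀ k', E₁.C'.Troubled k' → ¬ C₁.Troubled (E₁.ι k') → False := by
    intro k' hT' hT
    obtain ⟨a, ha⟩ := E₁.causedBy_of_new_troubled k' hT' hT
    rcases fin2_eq_or_eq_rev aX a with rfl | rfl
    · rw [h₀] at ha; exact not_causedBy_const ha
    · rw [hG₁Q] at ha
      rcases ha with ha | ⟨z, hz, -⟩
      · -- `k'` is `Q`, which is not ∧-type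
        have hιQ : E₁.ι k' = Q := (Node.gate.inj ha).symm
        obtain ⟨hand', -⟩ := hT'
        rw [E₁.isAndOp_iff, hιQ] at hand'
        exact hQand hand'
      · cases hz
  obtain ⟨P₁, hP₁', hpot₁⟩ := E₁.exists_packing_of_cover hP₁ ∅ ∅ (fun k' hT' hT => (hnonew k' hT' hT).elim)
    (Or.inl (by simp)) (Or.inl (by simp))
  simp only [if_true, Nat.cast_zero, add_zero] at hpot₁
  -- `Q` in the new circuit: a `0`-gate, not the output
  obtain ⟨kQ, hkQ⟩ := E₁.ι_surj Q fun h => by rw [h] at hG₁Q; exact (hF₁.not_reads_self_of_const h₀) _ hG₁Q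
  have hrepl : E₁.repl = .const (C₁.liveFn G aX b false) := rfl
  have hQ0 : E₁.C'.fanout (.gate kQ) = 0 := by
    have h1 := E₁.fanout_gate_add (k' := kQ) (by rw [hrepl]; exact fun h => by cases h)
    rw [hkQ] at h1
    have h2 : C₁.fanout (.gate Q) = 1 := by rw [C.fanout_substConst_gate]; exact hQ1
    have h3 : 1 ≤ (univ.filter fun a : Fin 2 => C₁.arg G a = .gate Q).card :=
      card_pos.mpr ⟨aX.rev, mem_filter.mpr ⟨mem_univ _, hG₁Q⟩⟩
    omega
  have hout₂ : E₁.C'.out ≠ .gate kQ := by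
    intro h
    have := E₁.out_eq
    rw [h, if_neg hout₁] at this
    change Node.gate (E₁.ι kQ) = C₁.out at this
    rw [hkQ] at this
    apply hQout
    -- `C₁.out = C.out.substConst`, and `C.out` is a gate (it is not `x`)
    have hCout : C₁.out = C.out.substConst x (finTwoEquiv c) := rfl
    rw [hCout] at this
    cases hco : C.out with
    | const b' => rw [hco] at this; cases this
    | var i =>
      rw [hco] at this
      by_cases hi : i = x
      · rw [hi, Node.substConst_var_self] at this; cases this
      · rw [Node.substConst_var_of_ne hi] at this; cases this
    | gate k => rw [hco] at this; exact this.symm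
  -- step 2: delete the `0`-gate `Q` (Rule 1, `ΔΦ ≤ 2`)
  have hno : ∀ k a, E₁.C'.arg k a ≠ .gate kQ := (fanout_eq_zero_iff _ _).mp hQ0
  let ε₂ := E₁.C'.skipEquiv kQ
  let C₂ := E₁.C'.removeGate kQ ε₂
  have hF₂ : C₂.Fair := E₁.fair.removeGate ε₂ hno
  have hC₂ : C₂.ComputesRestr f R₁ := E₁.computes.removeGate ε₂ E₁.fair hno hout₂
  obtain ⟨P₂, hP₂, hpot₂⟩ := E₁.C'.exists_packing_removeGate_le kQ ε₂ hno hP₁'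
  have hpot₂' : C₂.potential P₂ ≤ E₁.C'.potential P₁ + 2 := by
    refine hpot₂.trans ?_; split_ifs <;> norm_num
  -- step 3: `D` and `H` are fed by constants in `C₂`
  obtain ⟨kD, hkD⟩ := E₁.ι_surj D hDG
  obtain ⟨kH, hkH⟩ := E₁.ι_surj H hHG'
  have hD₁ : C₁.arg D aD = .const b := by
    show (C.arg D aD).substConst x (finTwoEquiv c) = _; rw [hDx, Node.substConst_var_self, hbc]
  have hH₁ : C₁.arg H aH = .gate G := by
    show (C.arg H aH).substConst x (finTwoEquiv c) = _; rw [hHG]; rfl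
  have hD' : E₁.C'.arg kD aD = .const b := (E₁.arg_eq_const_iff kD aD b).mpr (Or.inl (by rw [hkD]; exact hD₁))
  have hH' : E₁.C'.arg kH aH = .const (C₁.liveFn G aX b false) :=
    (E₁.arg_eq_const_iff kH aH _).mpr (Or.inr ⟨by rw [hkH]; exact hH₁, hrepl⟩)
  have hkDQ : kD ≠ kQ := fun h => hDQ (by rw [← hkD, ← hkQ, h])
  have hkHQ : kH ≠ kQ := fun h => hHQ (by rw [← hkH, ← hkQ, h])
  have hkDH : kD ≠ kH := fun h => hDH (by rw [← hkD, ← hkH, h])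
  have hcount : 2 ≤ C₂.constFedCount := by
    unfold constFedCount
    have hmem : ∀ {k : Fin E₁.C'.m} (hk : k ≠ kQ) {a : Fin 2} {b' : Bool}, E₁.C'.arg k a = .const b' →
        ε₂.symm ⟨k, hk⟩ ∈ univ.filter fun k => ∃ a b', C₂.arg k a = .const b' := by
      intro k hk a b' h
      refine mem_filter.mpr ⟨mem_univ _, a, b', ?_⟩
      show (E₁.C'.arg (ε₂ (ε₂.symm ⟨k, hk⟩)) a).skip kQ ε₂ = .const b'
      rw [Equiv.apply_symm_apply ε₂]
      show (E₁.C'.arg k a).skip kQ ε₂ = .const b'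
      rw [h]; rfl
    have hsub : ({ε₂.symm ⟨kD, hkDQ⟩, ε₂.symm ⟨kH, hkHQ⟩} : Finset _) ⊆
        univ.filter fun k => ∃ a b', C₂.arg k a = .const b' := by
      intro k hk
      rw [mem_insert, mem_singleton] at hk
      rcases hk with rfl | rfl
      · exact hmem hkDQ hD'
      · exact hmem hkHQ hH'
    have hne : ε₂.symm ⟨kD, hkDQ⟩ ≠ ε₂.symm ⟨kH, hkHQ⟩ := fun h => hkDH (by
      have := congrArg Subtype.val (ε₂.symm.injective h); exact this)
    have := card_le_card hsub
    rwa [card_pair hne] at this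
  obtain ⟨D', P', hF', hCD', hP', hm', hμ'⟩ := cascade hf hd₁ hφ hI αQ 2 C₂ P₂ hF₂ hC₂ hP₂ hcount
  -- accounting
  refine stepBranch2_of_assignFree_gain hφ hI hx hxp c hP hxinf (4 * (1 - αφ)) ?_ hF' hCD' hP' ?_
  · have := liYangDelta_le_case3 αφ αI αQ; linarith
  · -- `μ(D') ≤ μ(C₂) - 2(1-αφ) ≤ μ(E₁.C', P₁) - 1 + 2αφ - … ≤ μ(C₁) - 4(1 - αφ)`
    have hinf₂ : ((C₂.influential R₁).card : ℝ) ≤ (C₁.influential R₁).card := by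
      have h1 := E₁.C'.influential_removeGate_subset kQ ε₂ hno R₁
      have h2 := E₁.influential_subset R₁
      exact_mod_cast card_le_card (h1.trans h2)
    have hinf₁ : ((E₁.C'.influential R₁).card : ℝ) ≤ (C₁.influential R₁).card := by
      exact_mod_cast card_le_card (E₁.influential_subset R₁)
    have hm₁ := E₁.m_add_one
    have hm₂ := E₁.C'.removeGate_m_add_one kQ ε₂
    have hmC₂ : (C₂.m : ℝ) + 2 = C₁.m := by
      have : C₂.m + 2 = C₁.m := by change (E₁.C'.m - 1) + 2 = C₁.m; omega
      exact_mod_cast this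
    have hμ₂ : C₂.measure αφ αI αQ P₂ R₁ ≤
        C₁.measure αφ αI αQ (C.substConstPacking x (finTwoEquiv c) P) R₁ - 2 + 2 * αφ := by
      unfold measure
      nlinarith [mul_le_mul_of_nonneg_left hinf₂ hI, mul_le_mul_of_nonneg_left hpot₂' hφ,
        mul_le_mul_of_nonneg_left hpot₁ hφ]
    push_cast at hμ'
    linarith

end Semicircuit

end Literature.Computability.Complexity
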